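import Mathlib
import HarnessLib

/-!
# CM torsion core, helpers 1/8: cyclotomic factors, Euler’s function, the order bound

Helper file (1/8) for stub `stub_CMTorsionCoreOf` ((K†), the CM torsion core) of line
`Sketch` (isotypic–Minkowski reduction) of crux U
`Summit.ABC.ABC.Theses.IsogenyGlueCongruence.EllipticGluingPrimeBound` (stmt-ABC-13919); the stub
itself is proved in `…EllipticGluingPrimeBoundStubCMTorsionCoreOf`.

Pure arithmetic and linear algebra:
* `totient_orderOf_le` (registered sub-goal) — a finite-order integer matrix `C` (`C^m = 1`) with
  an eigenvalue `ζ` over a field where `m ≠ 0` has `φ(ord ζ) ≤ r` (`charpoly C` is a product of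
  cyclotomic polynomials `Φ_d`, `d ∣ m`);
* `CMTorsion.le_two_mul_totient_sq` — `n ≤ 2 φ(n)²`;
* `CMTorsion.prime_le_of_forall_pow_eq` — the order bound `ℓ ≤ 12 N + 1` from the identities
  `(a + d)^{12N} = (a - d)^{12N}`, `a ∈ 𝔽_ℓ`, `a² ≠ d²`;
* `CMTorsion.exists_fixed_of_fixed` — a vector over `𝔽̄_ℓ` fixed by `𝔽_ℓ`-matrices descends.

Everything is proved (axioms `propext`, `Classical.choice`, `Quot.sound`); no `def`, no named
fact. Deliberately NOT here: the plane algebra of the FACT-2 module (helpers 2–5/8), the geometry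
(helpers 7–8/8).
-/

noncomputable section

-- `Summit.<Summit>.<Problem>` is the mandated summit-side namespace (CONVENTIONS §2); for the
-- single-conjunct summit `ABC` the two coincide, so the duplicate `ABC.ABC` is deliberate.
set_option linter.dupNamespace false

namespace Summit.ABC.ABC.Theorems.IsotypicMinkowski

open scoped AddSubgroup Matrix

/-! ## Cyclotomic factors (registered sub-goal of the stub) -/


/-- **Cyclotomic factors of a finite-order integer matrix.** If `C ∈ M_r(ℤ)` has `C ^ m = 1` and,
over a field `F` with `m ≠ 0` in `F`, a non-zero eigenvector with eigenvalue `ζ`, then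
`φ(ord ζ) ≤ r`: every complex root of `charpoly C` is an `m`-th root of unity, so `charpoly C` is a
product of cyclotomic polynomials `Φ_d`, `d ∣ m` (`Φ_d = minpoly` of a primitive `d`-th root,
integrally closed `ℤ`); reducing modulo the characteristic, `ζ` is a root of some `Φ_d` with
`d ≠ 0` in `F`, hence a primitive `d`-th root of unity, and `φ(d) = deg Φ_d ≤ deg charpoly = r`.
[folklore] -/
theorem totient_orderOf_le {r m : ℕ} (hm : 0 < m) (C : Matrix (Fin r) (Fin r) ℤ)
    (hC : C ^ m = 1) {F : Type} [Field F] (hmF : (m : F) ≠ 0) {ζ : F} {x : Fin r → F}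
    (hx : x ≠ 0) (hζ : (C.map (Int.castRingHom F)) *ᵥ x = ζ • x) :
    Nat.totient (orderOf ζ) ≤ r := by
  classical
  -- eigenvalues: over any field, `M v = μ v`, `v ≠ 0` makes `μ` a root of `charpoly`
  have hroot : ∀ {K : Type} [Field K] (μ : K) (v : Fin r → K), v ≠ 0 →
      (C.map (Int.castRingHom K)) *ᵥ v = μ • v → (C.charpoly.map (Int.castRingHom K)).IsRoot μ := by
    intro K _ μ v hv hμ
    rw [← Matrix.charpoly_map, Polynomial.IsRoot.def, Matrix.eval_charpoly,
      ← Matrix.exists_mulVec_eq_zero_iff]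
    refine ⟨v, hv, ?_⟩
    rw [Matrix.sub_mulVec, hμ, sub_eq_zero]
    funext i
    rw [Matrix.scalar_apply, Matrix.mulVec_diagonal, Pi.smul_apply, smul_eq_mul]
  -- every complex root of `charpoly C` is an `m`-th root of unity
  have hunity : ∀ α : AlgebraicClosure ℚ, Polynomial.aeval α C.charpoly = 0 → α ^ m = 1 := by
    intro α hα
    have hα' : (C.charpoly.map (Int.castRingHom (AlgebraicClosure ℚ))).IsRoot α := by
      rw [Polynomial.IsRoot.def, Polynomial.eval_map, ← algebraMap_int_eq, ← Polynomial.aeval_def]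
      exact hα
    rw [← Matrix.charpoly_map, Polynomial.IsRoot.def, Matrix.eval_charpoly,
      ← Matrix.exists_mulVec_eq_zero_iff] at hα'
    obtain ⟨v, hv, hCv⟩ := hα'
    rw [Matrix.sub_mulVec, sub_eq_zero] at hCv
    have hCv' : (C.map (Int.castRingHom (AlgebraicClosure ℚ))) *ᵥ v = α • v := by
      rw [← hCv]
      funext i
      rw [Matrix.scalar_apply, Matrix.mulVec_diagonal, Pi.smul_apply, smul_eq_mul]
    have hpow : ∀ k : ℕ, ((C.map (Int.castRingHom (AlgebraicClosure ℚ))) ^ k) *ᵥ v = α ^ k • v := by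
      intro k
      induction k with
      | zero => rw [pow_zero, pow_zero, Matrix.one_mulVec, one_smul]
      | succ k ih => rw [pow_succ, ← Matrix.mulVec_mulVec, hCv', Matrix.mulVec_smul, ih, smul_smul,
          pow_succ']
    have h1 : (C.map (Int.castRingHom (AlgebraicClosure ℚ))) ^ m = 1 := by
      change ((Int.castRingHom (AlgebraicClosure ℚ)).mapMatrix C) ^ m = 1
      rw [← map_pow, hC, map_one]
    have h2 := hpow m
    rw [h1, Matrix.one_mulVec] at h2
    have h3 : (α ^ m - 1) • v = 0 := by rw [sub_smul, ← h2, one_smul, sub_self]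
    exact sub_eq_zero.1 ((smul_eq_zero.1 h3).resolve_right hv)
  -- the key induction on the degree
  have key : ∀ (k : ℕ) (p : Polynomial ℤ), p.Monic → p.natDegree = k →
      (∀ α : AlgebraicClosure ℚ, Polynomial.aeval α p = 0 → α ^ m = 1) →
      ∀ ζ : F, (p.map (Int.castRingHom F)).IsRoot ζ → Nat.totient (orderOf ζ) ≤ k := by
    intro k
    induction k using Nat.strong_induction_on with
    | _ k ih =>
    intro p hp hk hαm ζ hζ
    by_cases hk0 : k = 0
    · -- `p = 1` has no roots
      exfalso
      have hp1 : p = 1 := Polynomial.eq_one_of_monic_natDegree_zero hp (hk ▸ hk0)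
      rw [hp1, Polynomial.map_one, Polynomial.IsRoot.def, Polynomial.eval_one] at hζ
      exact one_ne_zero hζ
    -- a complex root `α` of `p`, a primitive `d`-th root of unity with `d ∣ m`
    have hdeg : p.degree ≠ 0 := by
      rw [Polynomial.degree_eq_natDegree hp.ne_zero, hk]
      exact_mod_cast hk0
    obtain ⟨α, hα⟩ := IsAlgClosed.exists_aeval_eq_zero (AlgebraicClosure ℚ) p hdeg
    have hαm' := hαm α hα
    have hαroot : (Polynomial.X ^ m - 1 : Polynomial (AlgebraicClosure ℚ)).IsRoot α := by
      rw [Polynomial.IsRoot.def, Polynomial.eval_sub, Polynomial.eval_pow, Polynomial.eval_X,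
        Polynomial.eval_one, hαm', sub_self]
    rw [← Polynomial.prod_cyclotomic_eq_X_pow_sub_one hm, Polynomial.IsRoot.def,
        Polynomial.eval_prod,
      Finset.prod_eq_zero_iff] at hαroot
    obtain ⟨d, hd, hdroot⟩ := hαroot
    have hdpos : 0 < d := Nat.pos_of_mem_divisors hd
    have hdm : d ∣ m := Nat.dvd_of_mem_divisors hd
    haveI : NeZero (d : AlgebraicClosure ℚ) := ⟨by exact_mod_cast hdpos.ne'⟩
    have hprim : IsPrimitiveRoot α d := Polynomial.isRoot_cyclotomic_iff.1 hdroot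
    -- `Φ_d ∣ p` over `ℤ`
    have hdvd : Polynomial.cyclotomic d ℤ ∣ p := by
      rw [Polynomial.cyclotomic_eq_minpoly hprim hdpos]
      exact minpoly.isIntegrallyClosed_dvd (hprim.isIntegral hdpos) hα
    obtain ⟨p', hp'⟩ := hdvd
    have hcycm : (Polynomial.cyclotomic d ℤ).Monic := Polynomial.cyclotomic.monic d ℤ
    have hp'm : p'.Monic := hcycm.of_mul_monic_left (hp' ▸ hp)
    have hdeg' : k = Nat.totient d + p'.natDegree := by
      rw [← hk, hp', hcycm.natDegree_mul hp'm, Polynomial.natDegree_cyclotomic]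
    have htot : 0 < Nat.totient d := Nat.totient_pos.2 hdpos
    -- `ζ` is a root of `Φ_d` or of `p'` over `F`
    rw [hp', Polynomial.map_mul, Polynomial.map_cyclotomic_int, Polynomial.IsRoot.def,
      Polynomial.eval_mul, mul_eq_zero] at hζ
    rcases hζ with hζ | hζ
    · -- `ζ` is a primitive `d`-th root of unity in `F`
      haveI : NeZero (d : F) := ⟨fun h ↦ hmF (by
        obtain ⟨e, rfl⟩ := hdm
        rw [Nat.cast_mul, h, zero_mul])⟩
      have hζprim : IsPrimitiveRoot ζ d := Polynomial.isRoot_cyclotomic_iff.1 hζ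
      rw [← hζprim.eq_orderOf]
      omega
    · have hlt : p'.natDegree < k := by omega
      have h := ih p'.natDegree hlt p' hp'm rfl (fun α' hα' ↦ hαm α' (by
        rw [hp', map_mul, hα', mul_zero])) ζ hζ
      omega
  exact key r C.charpoly (Matrix.charpoly_monic C) (by
    rw [Matrix.charpoly_natDegree_eq_dim, Fintype.card_fin]) hunity ζ (hroot ζ x hx hζ)

/-! ## Euler's function and the order bound -/


namespace CMTorsion

/-- **A polynomial lower bound for Euler's function: `n ≤ 2 φ(n)²`** (multiplicativity:
`p^k ≤ φ(p^k)²` for odd `p`, `2^k ≤ 2 φ(2^k)²`). Proof taken over from the line's wave-3 plan file.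
[folklore] -/
theorem le_two_mul_totient_sq (n : ℕ) : n ≤ 2 * Nat.totient n ^ 2 := by
  -- the multiplicative refinement: odd `n` satisfy `n ≤ φ(n)²`
  suffices h : (Odd n → n ≤ Nat.totient n ^ 2) ∧ n ≤ 2 * Nat.totient n ^ 2 from h.2
  induction n using Nat.recOnPosPrimePosCoprime with
  | zero => simp
  | one => simp
  | prime_pow p k hp hk =>
    have hφ : Nat.totient (p ^ k) = p ^ (k - 1) * (p - 1) := Nat.totient_prime_pow hp hk
    obtain ⟨j, rfl⟩ := Nat.exists_eq_succ_of_ne_zero hk.ne'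
    simp only [Nat.succ_sub_one] at hφ
    have hp2 := hp.two_le
    by_cases h2 : p = 2
    · subst h2
      refine ⟨fun hodd ↦ ?_, ?_⟩
      · exact absurd hodd
          (by rw [Nat.not_odd_iff_even]; exact (Nat.even_pow' (by omega)).2 even_two)
      · rw [hφ]
        have : 2 ^ (j + 1) ≤ 2 * (2 ^ j * 1) ^ 2 := by
          rw [mul_one, ← pow_mul, ← pow_succ']
          exact Nat.pow_le_pow_right (by norm_num) (by omega)
        simpa using this
    · have hp3 : 3 ≤ p := by
        rcases hp.eq_two_or_odd' with h | h
        · exact absurd h h2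
        · omega
      have key : p ^ (j + 1) ≤ (p ^ j * (p - 1)) ^ 2 := by
        have h1 : p ≤ (p - 1) ^ 2 := by
          obtain ⟨q, rfl⟩ : ∃ q, p = q + 1 := ⟨p - 1, by omega⟩
          have hq : 2 ≤ q := by omega
          rw [Nat.add_sub_cancel]
          nlinarith
        calc p ^ (j + 1) = p ^ j * p := pow_succ _ _
          _ ≤ (p ^ j) ^ 2 * (p - 1) ^ 2 := by
              refine Nat.mul_le_mul ?_ h1
              rw [sq]
              exact Nat.le_mul_of_pos_left _ (pow_pos hp.pos _)
          _ = (p ^ j * (p - 1)) ^ 2 := by ring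
      rw [hφ]
      exact ⟨fun _ ↦ key, key.trans (Nat.le_mul_of_pos_left _ two_pos)⟩
  | coprime a b ha hb hab iha ihb =>
    rw [Nat.totient_mul hab]
    refine ⟨fun hodd ↦ ?_, ?_⟩
    · obtain ⟨hoa, hob⟩ := Nat.odd_mul.1 hodd
      calc a * b ≤ Nat.totient a ^ 2 * Nat.totient b ^ 2 := Nat.mul_le_mul (iha.1 hoa) (ihb.1 hob)
        _ = (Nat.totient a * Nat.totient b) ^ 2 := by ring
    · -- at most one of two coprime numbers is even
      rcases Nat.even_or_odd a with hea | hoa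
      · have hob : Odd b := by
          by_contra hb'
          rw [Nat.not_odd_iff_even] at hb'
          have h2 : 2 ∣ Nat.gcd a b := Nat.dvd_gcd hea.two_dvd hb'.two_dvd
          rw [hab] at h2
          omega
        calc a * b ≤ (2 * Nat.totient a ^ 2) * Nat.totient b ^ 2 :=
              Nat.mul_le_mul iha.2 (ihb.1 hob)
          _ = 2 * (Nat.totient a * Nat.totient b) ^ 2 := by ring
      · calc a * b ≤ Nat.totient a ^ 2 * (2 * Nat.totient b ^ 2) :=
              Nat.mul_le_mul (iha.1 hoa) ihb.2
          _ = 2 * (Nat.totient a * Nat.totient b) ^ 2 := by ring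

/-- **The order bound.** Over a field `F ⊇ 𝔽_ℓ` (`ℓ > 3`) with `d² = D ≠ 0`: if
`(a + d)^{12N} = (a - d)^{12N}` for every `a ∈ 𝔽_ℓ` with `a² ≠ D`, and `ℓ ∤ N`, then `ℓ ≤ 12 N + 1`
—
the polynomial `(X + d)^{12N} - (X - d)^{12N}` is non-zero of degree `≤ 12N - 1` (its coefficient of
`X^{12N-1}` is `24 N d ≠ 0`) and has the `≥ ℓ - 2` roots `a`. [folklore] -/
theorem prime_le_of_forall_pow_eq {ℓ : ℕ} [Fact ℓ.Prime] (h3 : 3 < ℓ) {F : Type} [Field F]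
    [Algebra (ZMod ℓ) F] {D : ZMod ℓ} (hD : D ≠ 0) {d : F}
    (hd : d ^ 2 = algebraMap (ZMod ℓ) F D) {N : ℕ} (hN : 0 < N) (hℓN : ¬ ℓ ∣ N)
    (h : ∀ a : ZMod ℓ, a ^ 2 ≠ D →
      (algebraMap (ZMod ℓ) F a + d) ^ (12 * N) = (algebraMap (ZMod ℓ) F a - d) ^ (12 * N)) :
    ℓ ≤ 12 * N + 1 := by
  classical
  have hprime : ℓ.Prime := Fact.out
  haveI : CharP F ℓ := charP_of_injective_algebraMap (algebraMap (ZMod ℓ) F).injective ℓ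
  set n : ℕ := 12 * N with hn_def
  have hn0 : n ≠ 0 := by rw [hn_def]; omega
  -- `n ≠ 0` and `2 ≠ 0` in `F`, `d ≠ 0`
  have hnF : (n : F) ≠ 0 := by
    intro h
    rw [CharP.cast_eq_zero_iff F ℓ] at h
    rcases (Nat.Prime.dvd_mul hprime).1 h with h12 | hN'
    · rcases (Nat.Prime.dvd_mul hprime).1 (show ℓ ∣ 4 * 3 from h12) with h4 | h3'
      · have h2 : ℓ ∣ 2 := by
          rcases (Nat.Prime.dvd_mul hprime).1 (show ℓ ∣ 2 * 2 from h4) with h | h <;> exact h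
        have := (Nat.prime_dvd_prime_iff_eq hprime Nat.prime_two).1 h2
        omega
      · have := (Nat.prime_dvd_prime_iff_eq hprime Nat.prime_three).1 h3'
        omega
    · exact hℓN hN'
  have h2F : (2 : F) ≠ 0 := by
    intro h
    have h' : ((2 : ℕ) : F) = 0 := by exact_mod_cast h
    rw [CharP.cast_eq_zero_iff F ℓ] at h'
    have := (Nat.prime_dvd_prime_iff_eq hprime Nat.prime_two).1 h'
    omega
  have hd0 : d ≠ 0 := by
    intro h
    rw [h, zero_pow two_ne_zero, eq_comm, map_eq_zero_iff _ (algebraMap (ZMod ℓ) F).injective] at hd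
    exact hD hd
  -- the polynomial `(X + d)^n - (X - d)^n`, of degree `≤ n - 1`
  set Pol : Polynomial F := (Polynomial.X + Polynomial.C d) ^ n - (Polynomial.X + Polynomial.C
      (-d)) ^ n
    with hPol
  have hcoeff : ∀ k, Pol.coeff k =
      d ^ (n - k) * (n.choose k : F) - (-d) ^ (n - k) * (n.choose k : F) := fun k ↦ by
    rw [hPol, Polynomial.coeff_sub, Polynomial.coeff_X_add_C_pow, Polynomial.coeff_X_add_C_pow]
  have hcoeff_top : Pol.coeff (n - 1) = 2 * n * d := by
    obtain ⟨m, hm⟩ : ∃ m, n = m + 1 := ⟨n - 1, by omega⟩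
    rw [hcoeff, hm, Nat.add_sub_cancel, Nat.choose_succ_self_right, show m + 1 - m = 1
        by omega, pow_one,
      pow_one]
    push_cast
    ring
  have hPol0 : Pol ≠ 0 := fun h ↦ by
    have h1 := hcoeff_top
    rw [h, Polynomial.coeff_zero] at h1
    exact mul_ne_zero (mul_ne_zero h2F hnF) hd0 h1.symm
  have hdeg : Pol.natDegree ≤ n - 1 := by
    have hle : Pol.natDegree ≤ n := by
      rw [hPol]
      refine (Polynomial.natDegree_sub_le _ _).trans (max_le ?_ ?_) <;>
        exact (Polynomial.natDegree_pow_le).trans (by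
          rw [Polynomial.natDegree_X_add_C, mul_one])
    have hne : Pol.natDegree ≠ n := fun h ↦ by
      have h1 : Pol.leadingCoeff = 0 := by
        rw [Polynomial.leadingCoeff, h, hcoeff, Nat.sub_self, pow_zero, pow_zero, sub_self]
      exact hPol0 (Polynomial.leadingCoeff_eq_zero.1 h1)
    omega
  -- every `a ∈ 𝔽_ℓ` with `a² ≠ D` gives a root
  set Sbad : Finset (ZMod ℓ) := (Polynomial.X ^ 2 - Polynomial.C D : Polynomial (ZMod
      ℓ)).roots.toFinset
    with hSbad
  have hRne : (Polynomial.X ^ 2 - Polynomial.C D : Polynomial (ZMod ℓ)) ≠ 0 :=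
    Polynomial.X_pow_sub_C_ne_zero (by norm_num) D
  have hSbad_card : Sbad.card ≤ 2 := by
    calc Sbad.card ≤ Multiset.card (Polynomial.X ^ 2 - Polynomial.C D : Polynomial (ZMod ℓ)).roots
        :=
          Multiset.toFinset_card_le _
      _ ≤ (Polynomial.X ^ 2 - Polynomial.C D : Polynomial (ZMod ℓ)).natDegree :=
          Polynomial.card_roots' _
      _ = 2 := Polynomial.natDegree_X_pow_sub_C
  set Sgood : Finset (ZMod ℓ) := Finset.univ \ Sbad with hSgood
  have hSgood_card : ℓ - 2 ≤ Sgood.card := by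
    rw [hSgood, Finset.card_sdiff, Finset.card_univ, ZMod.card, Finset.inter_univ]
    omega
  have hroot : ∀ a ∈ Sgood, algebraMap (ZMod ℓ) F a ∈ Pol.roots.toFinset := by
    intro a ha
    rw [hSgood, Finset.mem_sdiff, hSbad, Multiset.mem_toFinset, Polynomial.mem_roots hRne,
      Polynomial.IsRoot.def, Polynomial.eval_sub, Polynomial.eval_pow, Polynomial.eval_X,
      Polynomial.eval_C, sub_eq_zero] at ha
    rw [Multiset.mem_toFinset, Polynomial.mem_roots hPol0, Polynomial.IsRoot.def, hPol,
      Polynomial.eval_sub, Polynomial.eval_pow, Polynomial.eval_pow, Polynomial.eval_add,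
      Polynomial.eval_add, Polynomial.eval_X, Polynomial.eval_C, Polynomial.eval_C, ←
          sub_eq_add_neg,
      h a ha.2, sub_self]
  have hcard_le : Sgood.card ≤ n - 1 := by
    calc Sgood.card = (Sgood.image (algebraMap (ZMod ℓ) F)).card :=
          (Finset.card_image_of_injective _ (algebraMap (ZMod ℓ) F).injective).symm
      _ ≤ Pol.roots.toFinset.card := Finset.card_le_card (by
          intro b hb
          obtain ⟨a, ha, rfl⟩ := Finset.mem_image.1 hb
          exact hroot a ha)
      _ ≤ Multiset.card Pol.roots := Multiset.toFinset_card_le _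
      _ ≤ Pol.natDegree := Polynomial.card_roots' _
      _ ≤ n - 1 := hdeg
  omega

/-! ## Descent of fixed vectors -/


/-- **Fixed vectors descend.** A non-zero vector over `𝔽̄_ℓ` fixed by a family of matrices with
entries in `𝔽_ℓ` yields a non-zero fixed vector over `𝔽_ℓ` (apply an `𝔽_ℓ`-linear functional not
vanishing on a non-zero coordinate). [folklore] -/
theorem exists_fixed_of_fixed {Γ : Type} {ℓ : ℕ} [Fact ℓ.Prime] {r : ℕ} (good : Γ → Prop)
    (c : Γ → Matrix (Fin r) (Fin r) (ZMod ℓ)) (x : Fin r → AlgebraicClosure (ZMod ℓ)) (hx : x ≠ 0)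
    (hfix : ∀ σ, good σ → ((c σ).map (algebraMap (ZMod ℓ) (AlgebraicClosure (ZMod ℓ)))) *ᵥ x = x) :
    ∃ x' : Fin r → ZMod ℓ, x' ≠ 0 ∧ ∀ σ, good σ → (c σ) *ᵥ x' = x' := by
  classical
  obtain ⟨k₀, hk₀⟩ : ∃ k₀, x k₀ ≠ 0 := by
    by_contra h
    push Not at h
    exact hx (funext h)
  let T : ZMod ℓ →ₗ[ZMod ℓ] AlgebraicClosure (ZMod ℓ) := LinearMap.toSpanSingleton (ZMod ℓ) _ (x k₀)
  have hT : ∀ t, T t = t • x k₀ := fun _ ↦ rfl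
  have hTinj : LinearMap.ker T = ⊥ := LinearMap.ker_eq_bot.2 (smul_left_injective (ZMod ℓ) hk₀)
  obtain ⟨lam, hlam⟩ := LinearMap.exists_leftInverse_of_injective T hTinj
  have hlam1 : lam (x k₀) = 1 := by
    have h := LinearMap.congr_fun hlam 1
    rw [LinearMap.comp_apply, hT, one_smul, LinearMap.id_apply] at h
    exact h
  refine ⟨fun k ↦ lam (x k), fun h ↦ one_ne_zero ((hlam1.symm.trans (congrFun h k₀))), fun σ hσ ↦
      ?_⟩
  funext k
  have h := congrFun (hfix σ hσ) k
  rw [Matrix.mulVec, dotProduct] at h ⊢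
  conv_rhs => rw [← h]
  rw [map_sum]
  refine Finset.sum_congr rfl fun i _ ↦ ?_
  rw [Matrix.map_apply, ← smul_eq_mul, ← Algebra.smul_def, map_smul, smul_eq_mul]

end CMTorsion

end Summit.ABC.ABC.Theorems.IsotypicMinkowski

end
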